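import Summits.BirchSwinnertonDyer.Rank1Residual.Additive.XGssRankZeroCyclotomicThree
import Summits.BirchSwinnertonDyer.Rank1Residual.Additive.QuadraticBaseChangeTamagawaCanonicalModelOddPrime
import HarnessLib

/-!
# Line V18 (X4 at `p = 3` over `K = ℚ(ζ₃)`, ranks `(0,0)`, good SUPERSINGULAR twist `V`, UPPER half) with Milne's A73 PROVED AWAY and NO local-population hypothesis
# (cell `b2b-bsdres`, team n1011, seat p16 GEN 11; lead R5-87 (e) (W2) = additive-p4 GEN 23 word: the
# UPPER / two-sided no-Milne twins of the additive-p4 ℚ(ζ₃) lines are the p16 lineage's; row T-MIL-CAN)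

HONEST FRAMING (cell `b2b-bsdres`, run/shared/lean/b2b/bsd-rank1-residual/, verbatim in every
file): the goal of the cell is to DELETE the COMBINATION-SHAPED residual classes of the
Birch–Swinnerton-Dyer formula for ALL analytic-rank `≤ 1` elliptic curves over `ℚ` — "full BSD
formula for every rank `≤ 1` curve in class `C`" assembled STRICTLY from published theorems — so
that the rank-`≤ 1` remainder becomes exactly the CONSTRUCTION-SHAPED classes, which are TYPED
(missing-input `Prop`s), NOT attempted. This is not "finishing BSD". Team n1011 (N10 / N11), seat p16:
research route; X3 / X4 / N10 / N11 labels and marks UNCHANGED; nothing booked. Theorems only.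

`XGssRankZeroCyclotomicThree.exists_padicVal_shaOrder_add_le` (seat additive-p4, file `XGssRankZeroCyclotomicThree.lean`; mathematics in
its docstrings) takes Milne 1972 as the WHOLE named fact A73
(`hMilne : Milne1972.bsdQuotient_baseChange_quadratic_anyModel`) and READS from it only (i) `Ш(V_K)` finite
and (ii) the `3`-adic valuation of the card identity
`C(V⊗K)·#Ш(V_K)·#V(ℚ)²·#W(ℚ)² = n_V·|u_C|·#Ш(V)·#Ш(W)·∏c(V)·∏c(W)·#V(K)²`. This file's `…_noLocal` takes
both from THEOREMS — `shaFinite_baseChange_of_twist` and T-MIL-CAN FILE 4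
`padicVal_card_identity_baseChange_of_natAbs_discr_eq` (`|d_K| = 3`, `V` good at `3`: the per-place fibre identities (T) hold at EVERY place — n1011-p01's T-MIL-3 H-5a with
rows T-MIL-B2 and T-A233 inside); the rest of the proof is additive-p4's VERBATIM (same surgery as
`X3RankZeroCyclotomicThreeNoLocal`). Binder diff vs the additive-p4 core = {`hMilne`} ↦ ∅, NOTHING
added; every other displayed hypothesis exactly as in the additive-p4 file. Nothing booked; no mark
moves. References: as in `XGssRankZeroCyclotomicThree`; Milne 1972 §1 Thm. 1 through Dokchitser–Dokchitser 2010 §2.1.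
-/

noncomputable section

open scoped Classical MatrixGroups ModularForm

open CongruenceSubgroup WeierstrassCurve NumberField IsDedekindDomain
  Literature.NumberTheory.EllipticCurves Literature.NumberTheory.EllipticCurves.ModularForms
  Literature.NumberTheory.EllipticCurves.Rank1Residual
  Literature.NumberTheory.EllipticCurves.Rank1Residual.Typed
  Literature.NumberTheory.EllipticCurves.Kobayashi2003
  Literature.NumberTheory.GaloisRepresentations

namespace Summit.BirchSwinnertonDyer.Rank1Residual.Additive

/-! ## The core theorem -/

section Core

variable (K : Type) [Field K] [NumberField K] [IsCyclotomicExtension {3} ℚ K]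
  (V : WeierstrassCurve ℚ) [V.IsElliptic] [V.IsGloballyMinimal]
  (W : WeierstrassCurve ℚ) [W.IsElliptic] [W.IsGloballyMinimal]

/-- **Core theorem of line V18, NO Milne, NO local population (`p = 3`, rank `0 + 0`, supersingular twist).** Let `V/ℚ` be globally
minimal with GOOD reduction at `3` and `a₃(V) = 0` (supersingular), `W = C • V^{(−3)}` a globally
minimal model of its twist by `−3 = d_K`, `K = ℚ(ζ₃)`, with `W` ADDITIVE at `3` (type `I₀*`), both of
analytic rank `0`; `f` the newform of `V`, `ϖ·Ω_V = Ω⁺_f`, `ϖ'·|Ω⁻(V)| = Ω⁻_f`, and `L` Kobayashi's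
`L₃⁺(V, X)` (`IsSignedPAdicLFunction f 3 1 L`). ASSUME, over `K`:
* `hexK` — the cyclotomic `ℤ₃`-extension `K_∞ = ℚ(ζ_{3^∞})` of `K` with a topological generator
  `γ`, `χ₃(γ)·ζ = 4` (tree theorem; inline);
* `hBK` — `V(K_∞)[3^∞] = 0` for every `ℤ₃`-extension of `K` (tree theorem from `Irr ∧ Ram`; inline);
* `hKobK` — **Kobayashi 2003 Thm. 4.1 (+, both `η`) read over `K`** (the named fact
  `Kobayashi2003.thm41_plusCharIdeal_dvd_cyclotomicThree` specialised to `V`, `K`, `V ⊗ K`, `L`, with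
  its surjectivity clause discharged): `X⁺(V/K_∞)` is finitely generated `Λ`-torsion and
  `ι g = u ϖϖ' · ι L · Lω` for some `g ∈ Char X⁺`, `Lω(0) = e·∑(a/3)[a/3]⁻_f`;
* `hnfK` — **Kitajima–Otsuki 2018 Main Thm. 1.3** (shape of the named fact
  `KitajimaOtsuki2018.mainThm13_plusSelmerDual_noFiniteSubmodule`): `X⁺(V/K_∞)` has no non-trivial
  finite `Λ`-submodule.
THEN — with NO Milne hypothesis (`Ш(V_K)` finite and the `3`-adic valuation of the card identity are the
THEOREMS `shaFinite_baseChange_of_twist` and T-MIL-CAN FILE 4 `padicVal_card_identity_baseChange_of_natAbs_discr_eq`;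
binder diff vs the additive-p4 core: `hMilne` DELETED, nothing added) — Gross–Zagier–Kolyvagin (`hGZK`)
and modularity (`hmod`): `#Ш_an(V) = q_V`, `#Ш_an(W) = q_W` are rationals with
**`ord₃ #Ш(V) + ord₃ #Ш(W) + 2 ord₃ #V(K) ≤ ord₃ q_V + ord₃ q_W + ord₃ ∏_w c_w(V_K)`**.
Proof: `g = h·f⁺`, `ord₃ #Ш(V_K)[3^∞] = ord₃ #Sel_{3^∞}(V_K) ≤ ord₃ f⁺(0) ≤ ord₃ g(0) =
ord₃(2ϖ[0]⁺_f) + ord₃(ϖ'S⁻)` (control inequality + interpolation), then Milne read in `ℚ`.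
[cite: Kobayashi2003, Thm. 4.1 (p. 8), Thm. 2.2, (3.6) (p. 7), Lemma 9.1 (p. 25)]
[cite: KitajimaOtsuki2018, Main Thm. 1.3] [cite: Milne1972ArithmeticAV, §1 Thm. 1 and §2 (through DokchitserDokchitserAnnals2010, §2.1, proof of Thm. 8)]
[cite: GreenbergLNM1716, §4 Lemma 4.2 (p. 102)] -/
theorem XGssRankZeroCyclotomicThree.exists_padicVal_shaOrder_add_le_noLocal
    (hGZK : rank_eq_analyticRank_of_analyticRank_le_one) (hmod : hasEntireLFunction_rat)
    (C : VariableChange ℚ) (hC : C • V.quadraticTwist (-(3 : ℚ)) = W)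
    (hgood : V.HasGoodReductionAtPrime 3) (ha3 : V.frobeniusTrace 3 = 0) (hadd : Addv W 3)
    (hrV : V.analyticRank = 0) (hrW : W.analyticRank = 0)
    {N : ℕ} [NeZero N] {f : CuspForm (Gamma0 N) 2} (hf : IsNewformOf V f)
    (ϖ ϖ' : ℚ) (hϖ : (ϖ : ℝ) * V.realPeriodRat = plusPeriod f)
    (hϖ' : (ϖ' : ℝ) * V.imaginaryPeriodRat = minusPeriod f)
    (L : IwasawaAlgebra 3) (hL : IsSignedPAdicLFunction f 3 1 L)
    (hexK : ∃ κ : ZpExtension K 3, κ.IsCyclotomic ∧ ∃ γ : Field.absoluteGaloisGroup K,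
      κ.IsTopGenerator γ ∧ ∃ ζ : ℤ_[3]ˣ, IsOfFinOrder ζ ∧
        ((GaloisRep.cyclotomicCharacter K 3 γ * ζ : ℤ_[3]ˣ) : ℤ_[3]) = (cyclotomicGenerator 3 : ℤ_[3]))
    (hBK : ∀ κ : ZpExtension K 3,
      FixedPoints.addSubgroup κ.kerSubgroup ((V.baseChange K).geomPrimaryTorsion 3) = ⊥)
    (hKobK : ∀ (κ : ZpExtension K 3) (γ : Field.absoluteGaloisGroup K),
      κ.IsCyclotomic → κ.IsTopGenerator γ →
      (∃ ζ : ℤ_[3]ˣ, IsOfFinOrder ζ ∧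
        ((GaloisRep.cyclotomicCharacter K 3 γ * ζ : ℤ_[3]ˣ) : ℤ_[3]) = (cyclotomicGenerator 3 : ℤ_[3])) →
      ∀ D : SignedSelmerDualData (V.baseChange K) κ γ 1,
        Module.Finite (IwasawaAlgebra 3) D.X ∧ Module.IsTorsion (IwasawaAlgebra 3) D.X ∧
        ∃ Lω : PowerSeries ℚ_[3],
          (∃ e : ℤ_[3]ˣ, PowerSeries.constantCoeff Lω =
            ((e : ℤ_[3]) : ℚ_[3]) * ((legendreMinusSymbolSum f 3 : ℚ) : ℚ_[3])) ∧
          ∃ g ∈ D.charIdeal, ∃ u : ℤ_[3]ˣ,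
            iwasawaToPowerSeries 3 g =
              PowerSeries.C (((u : ℤ_[3]) : ℚ_[3]) * (ϖ : ℚ_[3]) * (ϖ' : ℚ_[3])) *
                (iwasawaToPowerSeries 3 L * Lω))
    (hnfK : ∀ (κ : ZpExtension K 3) (γ : Field.absoluteGaloisGroup K),
      κ.IsCyclotomic → κ.IsTopGenerator γ →
      ∀ (D : SignedSelmerDualData (V.baseChange K) κ γ 1) [Module.Finite (IwasawaAlgebra 3) D.X],
        Module.IsTorsion (IwasawaAlgebra 3) D.X →
        ∀ N' : Submodule (IwasawaAlgebra 3) D.X, Finite N' → N' = ⊥) :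
    ∃ qV qW : ℚ, shaAn V = (qV : ℂ) ∧ shaAn W = (qW : ℂ) ∧
      (padicValNat 3 V.shaOrder : ℤ) + padicValNat 3 W.shaOrder +
          2 * padicValNat 3 (Nat.card (V.baseChange K).toAffine.Point) ≤
        padicValRat 3 qV + padicValRat 3 qW + padicValNat 3 (V.baseChange K).tamagawaProduct := by
  classical
  set p : ℕ := 3 with hp3
  -- §0 facts about `K`
  have h2 : Module.finrank ℚ K = 2 := finrank_eq_two_of_isCyclotomicExtension_three (K := K)
  have hdK : (NumberField.discr K : ℚ) = -(3 : ℚ) := by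
    rw [discr_cyclotomicThree K]; norm_num
  haveI : IsTotallyComplex K := isTotallyComplex_cyclotomicThree K
  have hC' : C • V.quadraticTwist (NumberField.discr K : ℚ) = W := by rw [hdK]; exact hC
  -- rank 0: `L(·,1) ≠ 0`, Mordell–Weil groups and `Ш` finite
  have hLV : V.entireLFunction 1 ≠ 0 := (V.analyticRank_eq_zero_iff_holds (hmod V)).mp hrV
  have hLW : W.entireLFunction 1 ≠ 0 := (W.analyticRank_eq_zero_iff_holds (hmod W)).mp hrW
  obtain ⟨hmwV, hfinV⟩ := hGZK V (by rw [hrV]; exact zero_le_one)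
  obtain ⟨hmwW, hfinW⟩ := hGZK W (by rw [hrW]; exact zero_le_one)
  haveI : Finite V.sha := hfinV
  haveI : Finite W.sha := hfinW
  haveI hEV : Finite V.toAffine.Point := V.finite_point_of_rank_zero (by rw [hmwV, hrV])
  haveI hEW : Finite W.toAffine.Point := W.finite_point_of_rank_zero (by rw [hmwW, hrW])
  -- the canonical `K`-model `V ⊗ K`: finiteness and Milne's identity
  -- `Ш(V_K)` finite and the `3`-adic valuation of the card identity are THEOREMS (NO Milne, NO local
  -- population: `shaFinite_baseChange_of_twist`, T-MIL-CAN FILE 4)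
  have hdKabs : (NumberField.discr K).natAbs = 3 := by rw [discr_cyclotomicThree K]; rfl
  have hWR₃ := padicVal_card_identity_baseChange_of_natAbs_discr_eq K V W 3 h2 hC' (by norm_num) hdKabs
    (Or.inl hgood) hfinV hfinW
  set VK := V.baseChange K with hVK
  haveI hEK : Finite VK.toAffine.Point := finite_point_baseChange_of_twist K V W h2 hC'
  have hshaK : VK.ShaFinite := shaFinite_baseChange_of_twist K V W h2 hC' hfinV hfinW
  haveI : Finite VK.sha := hshaK
  haveI : Finite (AddCommGroup.primaryComponent VK.sha p) :=
    Finite.of_injective _ Subtype.val_injective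
  -- the cyclotomic setting over `K`, the signed Iwasawa module `X⁺(V/K_∞)`
  obtain ⟨κ, hκ, γ, hγ, hγ'⟩ := hexK
  obtain ⟨D⟩ := nonempty_signedSelmerDualData VK κ 1 hγ
  -- Kobayashi over `K`
  obtain ⟨hfinX, hX, Lω, ⟨e, hLω⟩, g, hgmem, u, hιg⟩ := hKobK κ γ hκ hγ hγ' D
  haveI : Module.Finite (IwasawaAlgebra p) D.X := hfinX
  haveI : (Module.charIdeal (IwasawaAlgebra p) D.X).IsPrincipal := charIdeal_isPrincipal_holds p D.X
  obtain ⟨fE, hchar⟩ := Submodule.IsPrincipal.principal (Module.charIdeal (IwasawaAlgebra p) D.X)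
  have hchar' : D.charIdeal = Ideal.span {fE} := hchar
  have hgmem' : g ∈ Ideal.span {fE} := by rw [← hchar']; exact hgmem
  obtain ⟨h, hgh⟩ := Ideal.mem_span_singleton'.mp hgmem'
  -- the analytic side over `ℚ` for `V`: `t_V = ϖ [0]⁺_f = L(V,1)/Ω_V`
  set sV : ℚ := ratPlusSymbol f 0 with hsV
  set tV : ℚ := ϖ * sV with htV
  have hΩV : (V.realPeriodRat : ℂ) ≠ 0 := by exact_mod_cast V.realPeriodRat_pos_holds.ne'
  have hLvalV : V.entireLFunction 1 = (((sV : ℝ) * plusPeriod f : ℝ) : ℂ) := hf.entireLFunction_one_eq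
  have hqV' : V.entireLFunction 1 / (V.realPeriodRat : ℂ) = ((tV : ℚ) : ℂ) := by
    rw [hLvalV, ← hϖ, div_eq_iff hΩV, htV]
    push_cast
    ring
  have htV0 : tV ≠ 0 := by
    intro h0
    apply hLV
    have := (div_eq_iff hΩV).mp hqV'
    rw [this, h0]
    simp
  obtain ⟨-, -, -, hshaV⟩ := Wuthrich2014.shaAn_eq_of_L_one_div_eq hGZK V hLV hqV'
  -- the analytic side over `ℚ` for `W`: odd Birch + Pal
  obtain ⟨ε, hε, hLW_eq⟩ :=
    entireLFunction_one_eq_of_twist_neg 3 hmod (by norm_num) V W C hC hadd hf ϖ' hϖ'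
  set S : ℚ := legendreMinusSymbolSum f 3 with hS
  set cinf : ℕ := (W.baseChange ℝ).numRealComponents with hcinf
  set tW : ℚ := ε * (ϖ' * S) / (|(C.u : ℚ)| * (cinf : ℚ)) with htW
  have hΩW : (W.realPeriodRat : ℂ) ≠ 0 := by exact_mod_cast W.realPeriodRat_pos_holds.ne'
  have hqW' : W.entireLFunction 1 / (W.realPeriodRat : ℂ) = (tW : ℂ) := by
    rw [hLW_eq, mul_div_cancel_right₀ _ hΩW]
  obtain ⟨-, -, -, hshaW⟩ := Wuthrich2014.shaAn_eq_of_L_one_div_eq hGZK W hLW hqW'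
  have hua0 : |(C.u : ℚ)| ≠ 0 := abs_ne_zero.mpr C.u.ne_zero
  have hcinf0 : (cinf : ℚ) ≠ 0 := by
    rw [hcinf, numRealComponents]
    split_ifs <;> norm_num
  have hden0 : |(C.u : ℚ)| * (cinf : ℚ) ≠ 0 := mul_ne_zero hua0 hcinf0
  have hϖS : ϖ' * S ≠ 0 := by
    intro h0
    apply hLW
    rw [hLW_eq, htW, h0, mul_zero, zero_div, Rat.cast_zero, zero_mul]
  have hε0 : ε ≠ 0 := by rcases hε with h | h <;> rw [h] <;> norm_num
  have htW0 : tW ≠ 0 := by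
    rw [htW]
    exact div_ne_zero (mul_ne_zero hε0 hϖS) hden0
  have hvε : padicValRat 3 ε = 0 := by
    rcases hε with h | h
    · rw [h, padicValRat.one]
    · rw [h, padicValRat.neg, padicValRat.one]
  have hvtW : padicValRat 3 tW = padicValRat 3 (ϖ' * S) - padicValRat 3 |(C.u : ℚ)| := by
    rw [htW, padicValRat.div (mul_ne_zero hε0 hϖS) hden0, padicValRat.mul hε0 hϖS,
      padicValRat.mul hua0 hcinf0, hvε, padicValRat_numRealComponents_eq_zero W 3 (by norm_num)]
    ring
  -- the constant terms: `L(0) = 2[0]⁺_f`, `Lω(0) = e S⁻`, `g(0) = u ϖ ϖ' L(0) Lω(0)`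
  have hL0 : ((PowerSeries.constantCoeff L : ℤ_[3]) : ℚ_[3]) = ((2 * sV : ℚ) : ℚ_[3]) :=
    hL.constantCoeff_eq_of_eq_one (by norm_num) hf hgood ha3
  have hg0 : ((PowerSeries.constantCoeff g : ℤ_[3]) : ℚ_[3]) =
      ((u : ℤ_[3]) : ℚ_[3]) * ((e : ℤ_[3]) : ℚ_[3]) * 2 * ((tV : ℚ) : ℚ_[3]) *
        ((ϖ' * S : ℚ) : ℚ_[3]) := by
    rw [← constantCoeff_iwasawaToPowerSeries 3 g, hιg]
    simp only [map_mul, PowerSeries.constantCoeff_C, constantCoeff_iwasawaToPowerSeries, hL0, hLω,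
      htV, hS]
    push_cast
    ring
  -- `g(0) = h(0) · fE(0)`
  have hg0' : (PowerSeries.constantCoeff g : ℤ_[3]) =
      PowerSeries.constantCoeff h * PowerSeries.constantCoeff fE := by
    rw [← hgh, map_mul]
  -- names
  set h0 : ℚ_[3] := ((PowerSeries.constantCoeff h : ℤ_[3]) : ℚ_[3]) with hh0
  set f0 : ℚ_[3] := ((PowerSeries.constantCoeff fE : ℤ_[3]) : ℚ_[3]) with hf0
  set vK : ℕ := padicValNat 3 VK.tamagawaProduct with hvK
  have htVQ : ((tV : ℚ) : ℚ_[3]) ≠ 0 := by exact_mod_cast htV0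
  have hϖSQ : ((ϖ' * S : ℚ) : ℚ_[3]) ≠ 0 := by exact_mod_cast hϖS
  have h2Q : (2 : ℚ_[3]) ≠ 0 := by exact_mod_cast (by norm_num : (2 : ℕ) ≠ 0)
  have hue0 : ((u : ℤ_[3]) : ℚ_[3]) * ((e : ℤ_[3]) : ℚ_[3]) * 2 ≠ 0 :=
    mul_ne_zero (mul_ne_zero (coe_units_ne_zero 3 u) (coe_units_ne_zero 3 e)) h2Q
  have hg0ne : PowerSeries.constantCoeff g ≠ 0 := by
    intro h0'
    have h' : ((u : ℤ_[3]) : ℚ_[3]) * ((e : ℤ_[3]) : ℚ_[3]) * 2 * ((tV : ℚ) : ℚ_[3]) *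
        ((ϖ' * S : ℚ) : ℚ_[3]) = 0 := by rw [← hg0, h0', PadicInt.coe_zero]
    exact mul_ne_zero (mul_ne_zero hue0 htVQ) hϖSQ h'
  have hfE0 : PowerSeries.constantCoeff fE ≠ 0 := by
    intro h0'
    apply hg0ne
    rw [hg0', h0', mul_zero]
  have hh0ne : h0 ≠ 0 := by
    rw [hh0]
    intro h0'
    apply hg0ne
    rw [hg0', (PadicInt.coe_eq_zero.mp h0'), zero_mul]
  have hf0ne : f0 ≠ 0 := by
    rw [hf0]
    exact fun h' ↦ hfE0 (PadicInt.coe_eq_zero.mp h')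
  -- CONTROL INEQUALITY (Kobayashi Lemma 9.1 + Kitajima–Otsuki + Greenberg Lemma 4.2):
  -- `ord₃ #Sel_{3^∞}(V_K) ≤ ord₃ fE(0)`
  obtain ⟨-, hctl⟩ := SignedControlZero.padicValNat_card_selmerGroupPInfty_le VK hγ D hX (hBK κ)
    (hnfK κ γ hκ hγ D hX) hchar' hfE0
  have hvSel : (padicValNat 3 (Nat.card (VK.selmerGroupPInfty 3)) : ℤ) =
      (padicValNat 3 VK.shaOrder : ℤ) := by
    rw [VK.natCard_selmerGroupPInfty_eq_natCard_primaryComponent_sha 3,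
      padicValNat_card_addPrimaryComponent 3]
    rfl
  -- KEY identity in `ℚ₃`: `(u e 2) · t_V · (ϖ'S) = h(0) · fE(0)`
  have key : ((u : ℤ_[3]) : ℚ_[3]) * ((e : ℤ_[3]) : ℚ_[3]) * 2 * ((tV : ℚ) : ℚ_[3]) *
        ((ϖ' * S : ℚ) : ℚ_[3]) = h0 * f0 := by
    rw [← hg0, hg0', hh0, hf0]; push_cast; ring
  -- valuations of `key`
  have hvue : (((u : ℤ_[3]) : ℚ_[3]) * ((e : ℤ_[3]) : ℚ_[3]) * 2).valuation = 0 := by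
    rw [Padic.valuation_mul (mul_ne_zero (coe_units_ne_zero 3 u) (coe_units_ne_zero 3 e)) h2Q,
      Padic.valuation_mul (coe_units_ne_zero 3 u) (coe_units_ne_zero 3 e),
      valuation_coe_units_eq_zero, valuation_coe_units_eq_zero]
    have h2v : (2 : ℚ_[3]).valuation = 0 := by
      have h := Padic.valuation_natCast (p := 3) 2
      rw [show padicValNat 3 2 = 0 by norm_num] at h
      exact_mod_cast h
    rw [h2v]; ring
  have hval := congrArg Padic.valuation key
  rw [Padic.valuation_mul (mul_ne_zero hue0 htVQ) hϖSQ, Padic.valuation_mul hue0 htVQ, hvue,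
    Padic.valuation_ratCast, Padic.valuation_ratCast, Padic.valuation_mul hh0ne hf0ne] at hval
  -- (I''): `ord₃ #Ш(V_K) ≤ ord₃ t_V + ord₃ (ϖ'S)` (`ord₃ h(0) ≥ 0`, control inequality)
  have hh0val : 0 ≤ h0.valuation := by
    rw [hh0]
    exact PadicInt.valuation_coe_nonneg
  have hI : (padicValNat 3 VK.shaOrder : ℤ) ≤ padicValRat 3 tV + padicValRat 3 (ϖ' * S) := by
    rw [hvSel] at hctl
    rw [← hf0] at hctl
    linarith
  -- Milne's identity in valuations
  have hnV0 : ((V.baseChange ℝ).numRealComponents : ℚ) ≠ 0 := by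
    rw [numRealComponents]; split_ifs <;> norm_num
  have hSV0 : (V.shaOrder : ℚ) ≠ 0 := by exact_mod_cast (V.shaOrder_pos hfinV).ne'
  have hSW0 : (W.shaOrder : ℚ) ≠ 0 := by exact_mod_cast (W.shaOrder_pos hfinW).ne'
  have hSK0 : (VK.shaOrder : ℚ) ≠ 0 := by exact_mod_cast (VK.shaOrder_pos hshaK).ne'
  have hcV0 : (V.tamagawaProduct : ℚ) ≠ 0 := by exact_mod_cast V.tamagawaProduct_pos_holds.ne'
  have hcW0 : (W.tamagawaProduct : ℚ) ≠ 0 := by exact_mod_cast W.tamagawaProduct_pos_holds.ne'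
  have hNV0 : ((Nat.card V.toAffine.Point : ℕ) : ℚ) ≠ 0 := by exact_mod_cast Nat.card_pos.ne'
  have hNW0 : ((Nat.card W.toAffine.Point : ℕ) : ℚ) ≠ 0 := by exact_mod_cast Nat.card_pos.ne'
  have hNK0 : ((Nat.card VK.toAffine.Point : ℕ) : ℚ) ≠ 0 := by exact_mod_cast Nat.card_pos.ne'
  have hM0 : VK.modifiedTamagawaProduct ≠ 0 := modifiedTamagawaProduct_ne_zero VK
  have hvM : padicValRat 3 VK.modifiedTamagawaProduct = padicValNat 3 VK.tamagawaProduct :=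
    padicValRat_modifiedTamagawaProduct_baseChange V 3
      (fun hdvd ↦ V.not_hasGoodReductionAtPrime_of_dvd_minimalDiscriminantInt 3 hdvd hgood)
  have hvcard := hWR₃
  rw [hVK] at hM0
  rw [padicValRat.mul (mul_ne_zero (mul_ne_zero hM0 hSK0) (pow_ne_zero 2 hNV0)) (pow_ne_zero 2 hNW0),
    padicValRat.mul (mul_ne_zero hM0 hSK0) (pow_ne_zero 2 hNV0), padicValRat.mul hM0 hSK0,
    padicValRat.pow, padicValRat.pow,
    padicValRat.mul (mul_ne_zero (mul_ne_zero (mul_ne_zero (mul_ne_zero (mul_ne_zero hnV0 hua0) hSV0)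
      hSW0) hcV0) hcW0) (pow_ne_zero 2 hNK0),
    padicValRat.mul (mul_ne_zero (mul_ne_zero (mul_ne_zero (mul_ne_zero hnV0 hua0) hSV0) hSW0) hcV0) hcW0,
    padicValRat.mul (mul_ne_zero (mul_ne_zero (mul_ne_zero hnV0 hua0) hSV0) hSW0) hcV0,
    padicValRat.mul (mul_ne_zero (mul_ne_zero hnV0 hua0) hSV0) hSW0,
    padicValRat.mul (mul_ne_zero hnV0 hua0) hSV0, padicValRat.mul hnV0 hua0, padicValRat.pow,
    padicValRat_numRealComponents_eq_zero V 3 (by norm_num),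
    padicValRat.of_nat, padicValRat.of_nat, padicValRat.of_nat, padicValRat.of_nat,
    padicValRat.of_nat, padicValRat.of_nat, padicValRat.of_nat, padicValRat.of_nat] at hvcard
  rw [← hVK] at hvcard
  rw [hvM] at hvcard
  -- conclusion
  refine ⟨tV * (Nat.card V.toAffine.Point : ℚ) ^ 2 / (V.tamagawaProduct : ℚ),
    tW * (Nat.card W.toAffine.Point : ℚ) ^ 2 / (W.tamagawaProduct : ℚ), hshaV, hshaW, ?_⟩
  rw [padicValRat.div (mul_ne_zero htV0 (pow_ne_zero 2 hNV0)) hcV0,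
    padicValRat.mul htV0 (pow_ne_zero 2 hNV0), padicValRat.pow, padicValRat.of_nat, padicValRat.of_nat,
    padicValRat.div (mul_ne_zero htW0 (pow_ne_zero 2 hNW0)) hcW0,
    padicValRat.mul htW0 (pow_ne_zero 2 hNW0), padicValRat.pow, padicValRat.of_nat, padicValRat.of_nat,
    hvtW]
  push_cast at hI hvcard ⊢
  linarith

end Core

end Summit.BirchSwinnertonDyer.Rank1Residual.Additive

end
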